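import Literature.Topology.FourManifolds.LatticeFormsEichlerCriterionDivisor
import Literature.Topology.FourManifolds.LatticeFormsPrimitiveOrthogonal
import Literature.Topology.FourManifolds.LatticeFormsStableOrthogonalGroupIndex
import Literature.Topology.FourManifolds.LatticeFormsOverlatticeSignature
import HarnessLib

/-!
# Orbits and orthogonal complements of `(−2)`-vectors in `II_{2,8m+2}` and in `L_{2d}^{(m)} = 2U ⊕ mE₈(−1) ⊕ ⟨−2d⟩`
# (Gritsenko–Hulek–Sankaran, *Hirzebruch–Mumford proportionality and locally symmetric varieties of orthogonal
# type*, Doc. Math. 13 (2008), Prop. 2.4 (i)–(ii))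

Trunk T-4MAN vocabulary (`LatticeForms.lean`: `hyperbolicForm = U`, `e8Form`, `IsEven`, `IsUnimodular`;
`LatticeFormsHyperbolicEmbedding.lean`: `hyperbolicSum n = U^{⊕ n}`; `LatticeFormsOrthoSum.lean`: `BilinForm.prod`,
`IsometryEquiv.prodCongr ∕ prodAssoc`; `LatticeFormsEichlerCriterion.lean` ∕ `LatticeFormsEichlerCriterionDivisor.lean`:
two orthogonal hyperbolic pairs `TwoHyperbolicPairs B x y x₁ y₁`, the Eichler words `UGen`, `UGen.eval ∕ evalEquiv`,
the Eichler criterion with divisor `TwoHyperbolicPairs.exists_uGens_apply_eq_of_smul_eq_sub` and `E_U ⊂ Õ(L)`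
(`UGen.discriminantGroupCongr_evalEquiv`); `LatticeFormsPrimitiveOrbit.lean` ∕ `LatticeFormsPrimitiveOrthogonal.lean`:
Huybrechts' Cor. 14.1.10 and Example 14.1.11 (i), transport of orthogonal complements
`restrict_orthogonal_equivalent_of_isometryEquiv`, `(0, v)^⊥ = Λ₁ ⊕ v^⊥`, `(e + df)^⊥ ≃ ⟨−2d⟩ ⊂ U`;
`LatticeFormsStableOrthogonalGroupIndex.lean`: the tree's model `L_{2d} = (E₈(−1)^{⊕2} ⊕ U^{⊕2}) ⊕ ℤ(−2d)`;
`LatticeFormsDiscriminantFormIsometry.lean`: `IsometryEquiv.discriminantGroupCongr = ḡ ∈ O(A_L)`). Written for lane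
`lit-hodgefound` (Track 2 foundations; prover seat `lit-hodgefound-p18`, gen 41, row g41-#1). THEOREMS ONLY — no
definition, no named fact, no instance, no notation.

## Source, verbatim (V. Gritsenko, K. Hulek, G. K. Sankaran, Doc. Math. 13 (2008) 1–19, §2 "The branch divisors",
held text `paper:arxiv-math_0609774` pp. 5–6)

"Let `L` be an even integral lattice […] and let the divisor `div(r)` of `r ∈ L` be the positive generator of the ideal
`(l, L)`. […] **Proposition 2.4.** Suppose `d` is a positive integer. (i) Any two `(−2)`-vectors in the lattice
`II_{2,8m+2}` are equivalent modulo `O⁺(II_{2,8m+2})`, and the orthogonal complement of a `(−2)`-vector `r` is isometric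
to `K_{II}^{(m)} = U ⊕ mE₈(−1) ⊕ ⟨2⟩`. (ii) There is one `Õ⁺(L_{2d}^{(m)})`-orbit of `(−2)`-vectors `r` in `L_{2d}^{(m)}`
with `div(r) = 1`. If `d ≡ 1 mod 4` then there is a second orbit of `(−2)`-vectors, with `div(r) = 2`. The orthogonal
complement of a `(−2)`-vector `r` in `L_{2d}^{(m)}` is isometric to `K_{2d}^{(m)} = U ⊕ mE₈(−1) ⊕ ⟨2⟩ ⊕ ⟨−2d⟩`, if
`div(r) = 1`, and to `N_{2d}^{(m)} = U ⊕ mE₈(−1) ⊕ (1 2 ∕ (1−d)∕2 1)`, if `div(r) = 2`. […]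
*Proof.* If the lattice `L` contains two hyperbolic planes then according to the well-known result of Eichler (see [E])
the `Õ⁺(L)`-orbit of a primitive vector `l ∈ L` is completely defined by two invariants: by its length `(l,l)` and by
its image `l* + L` in the discriminant group `A_L`, where `l* = l/div(l)`. i) If `u` is a primitive vector of an even
unimodular lattice `II_{2,8m+2}` then `div(u) = 1` and there is only one `O(II_{2,8m+2})`-orbit of `(−2)`-vectors.
Therefore we can take `r` to be a `(−2)`-vector in `U`, and the form of the orthogonal complement is obvious. ii) In the
lattice `L_{2d}^{(m)}` we fix a generator `h` of its `⟨−2d⟩`-part. Then for any `r ∈ L_{2d}^{(m)}` we can write `r = u + xh`,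
where `u ∈ II_{2,8m+2}` and `x ∈ ℤ`. It is clear that `div(r)` divides `r²`. If `f ∣ div(r)`, where `f = 2`, `d` or `2d`,
then the vector `u` is also divisible by `f`. Therefore the `(−2)`-vectors form two possible orbits of vectors with
divisor equal to `1` or `2`. If `r² = −2` and `div(r) = 2` then `u = 2u₀` with `u₀ ∈ 2U ⊕ mE₈(−1)` and we see that in this
case `d ≡ 1 mod 4`. This gives us two different orbits for such `d`. In both cases we can find a `(−2)`-vector `r` in
the sublattice `U ⊕ ⟨−2d⟩`. Elementary calculation gives us the orthogonal complement of `r`."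

The same two lattices in GHS, Doc. Math. 12 (2007), §4.6 (held text `paper:arxiv-math_0512595` pp. 12–13): "Both of
these lattices `K_{2d}^{(m)}` and `N_{2d}^{(m)}` arise from the `(−2)`-reflective part of the ramification divisor […]
`K_{2d}^{(m)} = U ⊕ mE₈(−1) ⊕ ⟨2⟩ ⊕ ⟨−2d⟩` […] We assume that `d ≡ 1 mod 4` and consider the even lattice
`N_{2d}^{(m)} = U ⊕ mE₈(−1) ⊕ (2 1 ∕ 1 (1−d)∕2)`." GHS, Invent. Math. 169 (2007), §4 (held text
`paper:arxiv-math_0607339` p. 15) quotes the result: "The `(−2)`-vectors of `L_{2d}` form one or two (if `d ≡ 1 mod 4`)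
orbits with respect to the group `Õ⁺(L_{2d})`."

## Reading notes

* The `2 × 2` block of `N_{2d}^{(m)}` printed in Doc. Math. 13 as `(1 2 ∕ (1−d)∕2 1)` is not symmetric; the symmetric
  Gram matrix `(2 1 ∕ 1 (1−d)∕2)` of determinant `−d` printed in Doc. Math. 12 §4.6.2 for the same lattice is the one
  meant, and it is what §3 proves (`d = 4k + 1`, `(1−d)/2 = −2k`).
* GROUPS. The tree has no spinor norm ∕ orientation character, hence no `O⁺`, `Õ⁺`, `S̃O`. The printed proof is the
  Eichler criterion, whose words lie in every one of these groups; the theorems below are therefore stated (a) for the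
  group of admissible Eichler words `E_U` itself (transitivity by a word), (b) for `Õ(L) = {g : ḡ = id on A_L}`
  (`E_U ⊂ Õ`), (c) for `O(L)`; the orbit COUNTS are proved for `O(L)` and for `Õ(L)` — the divisor separates the two
  orbits already under `O(L)`, and `E_U` merges each divisor class already inside `Õ(L)`.
  TODO(general form): `Õ⁺(L_{2d}^{(m)})`-orbits once the real spinor norm is in the tree.
* ABSTRACTION. (ii) is proved for every `L = B₀ ⊕ ⟨−2d⟩` with `B₀` symmetric even unimodular containing two orthogonal
  hyperbolic pairs (`II_{2,8m+2} = 2U ⊕ mE₈(−1)` is the printed `B₀`); instead of the class `r* + L` the proof checks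
  `u ≡ v (mod div·L)` directly (`u = 2u₀ + sh`, `s` odd), which is what the tree's Eichler criterion consumes.
  (i) is proved for every symmetric even unimodular lattice with `n± ≥ 2`; the complements are computed in the model
  `L_{2d}^{(m)} = (E₈(−1)^{⊕m} ⊕ U^{⊕2}) ⊕ ℤ(−2d)` — for `m = 2` verbatim the tree's `L_{2d}`
  (`LatticeFormsStableOrthogonalGroupIndex`, `latticeL2d_…`) — in the bracketings
  `K_{2d}^{(m)} ≅ ((E₈(−1)^{⊕m} ⊕ U) ⊕ ⟨2⟩) ⊕ ⟨−2d⟩` and `N_{2d}^{(m)} ≅ (E₈(−1)^{⊕m} ⊕ U) ⊕ (2 1 ∕ 1 −2k)`.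
* `(−2)`-vectors are automatically primitive in an even lattice (§2), so "primitive" is not a hypothesis.
* Prop. 2.4 (iii) (complements of `(−2d)`-vectors) is Prop. 4.6 of GHS 2007, in the tree as
  `LatticeFormsNegTwoDVectorOrthogonal.lean`; (iv) (orbit counts of `(−2d)`-vectors) is not in this file.

## Contents (all proved)

* §1 `L = B₀ ⊕ ⟨−2d⟩`: `prod_neg_twoMul_smul_mul_apply`, `TwoHyperbolicPairs.inl`, symmetry ∕ evenness ∕
  nondegeneracy; the divisor dichotomy `exists_apply_eq_one_or_forall_two_dvd_of_apply_self_eq_neg_two`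
  (`div(r) ∈ {1, 2}`); `exists_fst_eq_two_smul_of_forall_two_dvd` (`2 ∣ div(r) ⟹ u ∈ 2B₀`);
  **`odd_snd_and_mod_four_eq_one_of_forall_two_dvd`** (`div(r) = 2 ⟹ x` odd and `d ≡ 1 mod 4`); existence of both
  kinds (`exists_apply_self_eq_neg_two_and_apply_eq_one`, `exists_apply_self_eq_neg_two_and_forall_two_dvd`);
  TRANSITIVITY by Eichler words `exists_uGens_apply_eq_of_apply_self_eq_neg_two_of_apply_eq_one ∕ _of_forall_two_dvd`
  and by isometries trivial on `A_L`
  (`exists_isometryEquiv_apply_eq_of_apply_self_eq_neg_two_of_apply_eq_one ∕ _of_forall_two_dvd`); invariance of the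
  divisor (`forall_dvd_apply_iff_of_isometryEquiv`, `exists_apply_eq_iff_of_isometryEquiv`); the ORBIT COUNTS
  **`natCard_quot_isometryEquiv_apply_self_eq_neg_two`** (`O(L)`: `2` if `d ≡ 1 mod 4`, else `1`) and
  **`natCard_quot_stable_isometryEquiv_apply_self_eq_neg_two`** (`Õ(L)`, same count).
* §2 Prop. 2.4 (i) for even unimodular lattices with `n± ≥ 2`: `(−2)`-vectors are primitive
  (`mem_span_singleton_of_smul_mem_of_apply_self_eq_neg_two`), one `O`-orbit
  (`exists_isometryEquiv_apply_eq_of_apply_self_eq_neg_two`, `natCard_quot_isometryEquiv_apply_self_eq_neg_two_of_isUnimodular`),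
  and `r^⊥ ≃ E₈(∓1)^{⊕m} ⊕ U^{⊕k} ⊕ ⟨2⟩` (`restrict_orthogonal_equivalent_of_apply_self_eq_neg_two_of_signature_nonpos ∕ _nonneg`).
* §3 the model `L_{2d}^{(m)}`: the orbit counts `natCard_quot_isometryEquiv_latticeL2dm_apply_self_eq_neg_two`,
  `natCard_quot_stable_isometryEquiv_latticeL2dm_apply_self_eq_neg_two`; `(v, 0)^⊥ = v^⊥ ⊕ Λ₂`
  (`restrict_orthogonal_prod_zero_equivalent`); the rank-`2` computation in `U ⊕ ⟨−2d⟩`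
  (`restrict_orthogonal_hyperbolicForm_prod_neg_twoMul_smul_mul_equivalent`); and the complements
  **`restrict_orthogonal_latticeL2dm_equivalent_of_apply_eq_one`** (`≅ K_{2d}^{(m)}`) and
  **`restrict_orthogonal_latticeL2dm_equivalent_of_forall_two_dvd`** (`≅ N_{2d}^{(m)}`, `d = 4k + 1`).

## References

* [GritsenkoHulekSankaran2008Proportionality] V. Gritsenko, K. Hulek, G. K. Sankaran, Hirzebruch–Mumford
  proportionality and locally symmetric varieties of orthogonal type, Doc. Math. 13 (2008) 1–19
  (arXiv:math/0609774): §2, Prop. 2.4 (i), (ii) and proof.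
* [GritsenkoHulekSankaran2007HM] V. Gritsenko, K. Hulek, G. K. Sankaran, The Hirzebruch–Mumford volume for the
  orthogonal group and applications, Doc. Math. 12 (2007) 215–241: §4.6.1 (`K_{2d}^{(m)}`), §4.6.2 (`N_{2d}^{(m)}`).
* [GritsenkoHulekSankaran2007Kodaira] V. Gritsenko, K. Hulek, G. K. Sankaran, The Kodaira dimension of the moduli of
  K3 surfaces, Invent. Math. 169 (2007) 519–567: §4 (the quoted orbit statement).
* [GritsenkoHulekSankaran2009] V. Gritsenko, K. Hulek, G. K. Sankaran, Abelianisation of orthogonal groups and the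
  fundamental group of modular varieties, J. Algebra 322 (2009): §3.2–3.3, Prop. 3.3 (i) (Eichler criterion, `E_U(L₁)`).
* [Huybrechts2016K3] D. Huybrechts, Lectures on K3 Surfaces, CUP 2016, Ch. 14 Cor. 1.10, Example 1.11 (i).
* [Serre1973] J.-P. Serre, A Course in Arithmetic, GTM 7, Ch. V §1.2 (orthogonal sums).
-/

noncomputable section

open Module Function
open LinearMap (BilinForm)
open LinearMap.BilinForm

namespace Literature.Topology.FourManifolds

universe u

/-! ### §1 `(−2)`-vectors of `B₀ ⊕ ⟨−2d⟩`, `B₀` even unimodular with two hyperbolic planes -/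

section Abstract

variable {M : Type u} [AddCommGroup M] (B₀ : BilinForm ℤ M) (d : ℕ)

/-- Evaluation of `B₀ ⊕ ⟨−2d⟩`: `((u, s), (v, t)) ↦ (u, v) − 2d·s·t`. [cite: GritsenkoHulekSankaran2008Proportionality, §2 proof of Prop. 2.4 (ii) ("we can write `r = u + xh`, where `u ∈ II_{2,8m+2}` and `x ∈ ℤ`")] -/
theorem prod_neg_twoMul_smul_mul_apply (p q : M × ℤ) :
    B₀.prod ((-(2 * d : ℤ)) • LinearMap.mul ℤ ℤ) p q = B₀ p.1 q.1 - 2 * d * (p.2 * q.2) := by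
  rw [LinearMap.BilinForm.prod_apply, smul_mul_apply]
  ring

/-- Two orthogonal hyperbolic pairs of `Λ₁` are two orthogonal hyperbolic pairs of `Λ₁ ⊕ Λ₂`.
[cite: GritsenkoHulekSankaran2009, §3.2 ("`L = U ⊕ U₁ ⊕ L₀`")] -/
theorem TwoHyperbolicPairs.inl {N : Type*} [AddCommGroup N] {Q : BilinForm ℤ M} {S : BilinForm ℤ N}
    (hS : S.IsSymm) {x y x₁ y₁ : M} (h : TwoHyperbolicPairs Q x y x₁ y₁) :
    TwoHyperbolicPairs (Q.prod S) (x, 0) (y, 0) (x₁, 0) (y₁, 0) := by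
  have key : ∀ a b : M, (Q.prod S) (a, 0) (b, 0) = Q a b := fun a b ↦ by
    rw [LinearMap.BilinForm.prod_apply]
    simp
  exact { isSymm := h.isSymm.prod hS
          xx := by rw [key]; exact h.xx
          yy := by rw [key]; exact h.yy
          xy := by rw [key]; exact h.xy
          x₁x₁ := by rw [key]; exact h.x₁x₁
          y₁y₁ := by rw [key]; exact h.y₁y₁
          x₁y₁ := by rw [key]; exact h.x₁y₁
          xx₁ := by rw [key]; exact h.xx₁
          xy₁ := by rw [key]; exact h.xy₁
          yx₁ := by rw [key]; exact h.yx₁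
          yy₁ := by rw [key]; exact h.yy₁ }

/-- `B₀ ⊕ ⟨−2d⟩` is symmetric and even when `B₀` is. [cite: GritsenkoHulekSankaran2008Proportionality, §2 ("the lattice `L_{2d}^{(m)} = 2U ⊕ mE₈(−1) ⊕ ⟨−2d⟩`")] -/
theorem isSymm_isEven_prod_neg_twoMul_smul_mul (hs : B₀.IsSymm) (he : B₀.IsEven) :
    (B₀.prod ((-(2 * d : ℤ)) • LinearMap.mul ℤ ℤ)).IsSymm ∧ (B₀.prod ((-(2 * d : ℤ)) • LinearMap.mul ℤ ℤ)).IsEven :=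
  ⟨hs.prod (isSymm_smul_mul _),
    isEven_prod_iff.2 ⟨he, fun x ↦ ⟨-(d * (x * x)), by rw [smul_mul_apply]; ring⟩⟩⟩

/-- `B₀ ⊕ ⟨−2d⟩` is nondegenerate when `B₀` is unimodular and `d ≥ 1`.
[cite: GritsenkoHulekSankaran2008Proportionality, §2] -/
theorem nondegenerate_prod_neg_twoMul_smul_mul (hu : B₀.IsUnimodular) (hd : 0 < d) :
    (B₀.prod ((-(2 * d : ℤ)) • LinearMap.mul ℤ ℤ)).Nondegenerate :=
  hu.nondegenerate.prod ((nondegenerate_zsmul_iff _ (by omega)).2 nondegenerate_mul)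

/-- **"It is clear that `div(r)` divides `r²`"** for `r² = −2`: the ideal `(r, L)` contains `2`, so it is `ℤ` or
`2ℤ` — either `r` has a dual vector (`(r, r') = 1`, `div(r) = 1`) or all `(r, z)` are even (`div(r) = 2`, attained
by `r' = −r… ` i.e. `(r, −r)/… `; here: `(r, z)` odd for some `z` gives `(r, z + jr) = 1`).
[cite: GritsenkoHulekSankaran2008Proportionality, Prop. 2.4 (ii) proof ("It is clear that `div(r)` divides `r²` … the `(−2)`-vectors form two possible orbits of vectors with divisor equal to `1` or `2`")] -/
theorem exists_apply_eq_one_or_forall_two_dvd_of_apply_self_eq_neg_two {W : Type*} [AddCommGroup W]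
    (B : BilinForm ℤ W) {r : W} (hr : B r r = -2) :
    (∃ r', B r r' = 1) ∨ ∀ z, (2 : ℤ) ∣ B r z := by
  by_cases h : ∀ z, (2 : ℤ) ∣ B r z
  · exact Or.inr h
  · simp only [not_forall] at h
    obtain ⟨z, hz⟩ := h
    have hodd : Odd (B r z) := Int.not_even_iff_odd.1 fun h2 ↦ hz (even_iff_two_dvd.1 h2)
    obtain ⟨j, hj⟩ := hodd
    refine Or.inl ⟨z + j • r, ?_⟩
    rw [map_add, map_zsmul, smul_eq_mul, hj, hr]
    ring

variable {B₀}

/-- **"If `2 ∣ div(r)` then the vector `u` is also divisible by `2`"**: for `r = u + xh ∈ B₀ ⊕ ⟨−2d⟩` with all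
`(r, z)` even and `B₀` unimodular, `u ∈ 2B₀`. [cite: GritsenkoHulekSankaran2008Proportionality, Prop. 2.4 (ii) proof] -/
theorem exists_fst_eq_two_smul_of_forall_two_dvd (hu : B₀.IsUnimodular) {r : M × ℤ}
    (h2 : ∀ z, (2 : ℤ) ∣ B₀.prod ((-(2 * d : ℤ)) • LinearMap.mul ℤ ℤ) r z) : ∃ u₀ : M, r.1 = (2 : ℤ) • u₀ := by
  haveI : B₀.IsPerfPair := hu
  refine exists_eq_smul_of_forall_dvd (B := B₀) fun v ↦ ?_
  have h := h2 (v, 0)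
  rwa [prod_neg_twoMul_smul_mul_apply, mul_zero, mul_zero, sub_zero] at h

/-- **"If `r² = −2` and `div(r) = 2` then `u = 2u₀` … and we see that in this case `d ≡ 1 mod 4`"** — and the
`h`-coefficient `x` of `r` is odd: `−2 = 4u₀² − 2dx²` with `u₀²` even gives `dx² = 4k + 1`.
[cite: GritsenkoHulekSankaran2008Proportionality, Prop. 2.4 (ii) proof] -/
theorem odd_snd_and_mod_four_eq_one_of_forall_two_dvd (hu : B₀.IsUnimodular) (he : B₀.IsEven) {r : M × ℤ}
    (hr : B₀.prod ((-(2 * d : ℤ)) • LinearMap.mul ℤ ℤ) r r = -2)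
    (h2 : ∀ z, (2 : ℤ) ∣ B₀.prod ((-(2 * d : ℤ)) • LinearMap.mul ℤ ℤ) r z) : Odd r.2 ∧ d % 4 = 1 := by
  obtain ⟨u₀, hu₀⟩ := exists_fst_eq_two_smul_of_forall_two_dvd d hu h2
  obtain ⟨k, hk⟩ := he u₀
  rw [prod_neg_twoMul_smul_mul_apply, hu₀, map_zsmul, map_zsmul, LinearMap.smul_apply, smul_eq_mul, smul_eq_mul,
    hk] at hr
  -- `hr : 2 * (2 * (k + k)) - 2 * d * (x * x) = -2`, i.e. `d x² = 4k + 1`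
  have hx : Odd r.2 := by
    refine Int.not_even_iff_odd.1 ?_
    rintro ⟨j, hj⟩
    rw [hj] at hr
    have h1 : (2 : ℤ) * (2 * (k + k)) - 2 * d * ((j + j) * (j + j)) = 8 * (k - d * (j * j)) := by ring
    rw [h1] at hr
    omega
  refine ⟨hx, ?_⟩
  obtain ⟨j, hj⟩ := hx
  have h1 : (d : ℤ) * (r.2 * r.2) = 4 * k + 1 := by linarith
  rw [hj] at h1
  have h3 : (d : ℤ) % 4 = 1 := by
    have h4 : (d : ℤ) * ((2 * j + 1) * (2 * j + 1)) = d + 4 * (d * (j * j + j)) := by ring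
    omega
  omega

/-- **Existence, `div(r) = 1`**: `r = e − f` in a hyperbolic plane of `B₀` is a `(−2)`-vector of `B₀ ⊕ ⟨−2d⟩` with a
dual vector ("In both cases we can find a `(−2)`-vector `r` in the sublattice `U ⊕ ⟨−2d⟩`").
[cite: GritsenkoHulekSankaran2008Proportionality, Prop. 2.4 (ii) proof] -/
theorem exists_apply_self_eq_neg_two_and_apply_eq_one {x y x₁ y₁ : M} (h : TwoHyperbolicPairs B₀ x y x₁ y₁) :
    ∃ r r' : M × ℤ, B₀.prod ((-(2 * d : ℤ)) • LinearMap.mul ℤ ℤ) r r = -2 ∧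
      B₀.prod ((-(2 * d : ℤ)) • LinearMap.mul ℤ ℤ) r r' = 1 := by
  refine ⟨(x - y, 0), (-x, 0), ?_, ?_⟩
  · rw [prod_neg_twoMul_smul_mul_apply]
    dsimp only
    simp only [map_sub, LinearMap.sub_apply, h.xx, h.yy, h.xy, h.isSymm.eq y x]
    ring
  · rw [prod_neg_twoMul_smul_mul_apply]
    dsimp only
    simp only [map_sub, LinearMap.sub_apply, map_neg, h.xx, h.isSymm.eq y x, h.xy]
    ring

/-- **Existence, `div(r) = 2` when `d ≡ 1 mod 4`**: for `d = 4k + 1`, `r = 2e + 2kf + h` has `r² = 8k − 2d = −2`,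
`(r, f) = 2` and all `(r, z)` even. [cite: GritsenkoHulekSankaran2008Proportionality, Prop. 2.4 (ii) proof ("This gives us two different orbits for such `d`. In both cases we can find a `(−2)`-vector `r` in the sublattice `U ⊕ ⟨−2d⟩`")] -/
theorem exists_apply_self_eq_neg_two_and_forall_two_dvd {x y x₁ y₁ : M} (h : TwoHyperbolicPairs B₀ x y x₁ y₁)
    (hd : d % 4 = 1) :
    ∃ r r' : M × ℤ, B₀.prod ((-(2 * d : ℤ)) • LinearMap.mul ℤ ℤ) r r = -2 ∧
      B₀.prod ((-(2 * d : ℤ)) • LinearMap.mul ℤ ℤ) r r' = 2 ∧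
        ∀ z, (2 : ℤ) ∣ B₀.prod ((-(2 * d : ℤ)) • LinearMap.mul ℤ ℤ) r z := by
  obtain ⟨k, hk⟩ : ∃ k : ℕ, d = 4 * k + 1 := ⟨d / 4, by omega⟩
  refine ⟨((2 : ℤ) • x + (2 * k : ℤ) • y, 1), (y, 0), ?_, ?_, fun z ↦ ?_⟩
  · rw [prod_neg_twoMul_smul_mul_apply]
    dsimp only
    simp only [map_add, map_zsmul, LinearMap.add_apply, LinearMap.smul_apply, smul_eq_mul, h.xx, h.yy, h.xy,
      h.isSymm.eq y x, hk]
    push_cast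
    ring
  · rw [prod_neg_twoMul_smul_mul_apply]
    dsimp only
    simp only [map_add, map_zsmul, LinearMap.add_apply, LinearMap.smul_apply, smul_eq_mul, h.yy, h.xy]
    ring
  · rw [prod_neg_twoMul_smul_mul_apply]
    dsimp only
    simp only [map_add, map_zsmul, LinearMap.add_apply, LinearMap.smul_apply, smul_eq_mul]
    exact ⟨B₀ x z.1 + k * B₀ y z.1 - d * z.2, by ring⟩

/-! #### Transitivity (Eichler's criterion) -/

/-- **One orbit of `(−2)`-vectors with `div(r) = 1`** — under the group `E_U` of admissible Eichler words already:
two `(−2)`-vectors `u, v` of `B₀ ⊕ ⟨−2d⟩` having dual vectors (`(u,u') = (v,v') = 1`) are joined by an admissible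
word in the Eichler transvections of the two hyperbolic planes of `B₀` ("according to the well-known result of
Eichler the orbit of a primitive vector `l` is completely defined by its length `(l,l)` and by `l* + L`"; here
`l* = l ∈ L`). [cite: GritsenkoHulekSankaran2008Proportionality, Prop. 2.4 (ii) and its proof] [cite: GritsenkoHulekSankaran2009, Prop. 3.3 (i)] -/
theorem exists_uGens_apply_eq_of_apply_self_eq_neg_two_of_apply_eq_one (he : B₀.IsEven) {x y x₁ y₁ : M}
    (h : TwoHyperbolicPairs B₀ x y x₁ y₁) {u v u' v' : M × ℤ}
    (huu : B₀.prod ((-(2 * d : ℤ)) • LinearMap.mul ℤ ℤ) u u = -2)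
    (hvv : B₀.prod ((-(2 * d : ℤ)) • LinearMap.mul ℤ ℤ) v v = -2)
    (hu' : B₀.prod ((-(2 * d : ℤ)) • LinearMap.mul ℤ ℤ) u u' = 1)
    (hv' : B₀.prod ((-(2 * d : ℤ)) • LinearMap.mul ℤ ℤ) v v' = 1) :
    ∃ l : List (UGen (M × ℤ)),
      (∀ g ∈ l, g.IsAdmissible (B₀.prod ((-(2 * d : ℤ)) • LinearMap.mul ℤ ℤ)) (x, 0) (y, 0)) ∧
        UGen.eval (B₀.prod ((-(2 * d : ℤ)) • LinearMap.mul ℤ ℤ)) (x, 0) (y, 0) l u = v :=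
  (h.inl (isSymm_smul_mul _)).exists_uGens_apply_eq_of_smul_eq_sub
    (isSymm_isEven_prod_neg_twoMul_smul_mul B₀ d h.isSymm he).2 (huu.trans hvv.symm) (fun _ ↦ one_dvd _) hu' hv'
    (one_smul ℤ (u - v))

/-- **One orbit of `(−2)`-vectors with `div(r) = 2`** (under `E_U`): two `(−2)`-vectors `u, v` of `B₀ ⊕ ⟨−2d⟩` with all
products even are joined by an admissible Eichler word — `u = 2u₀ + sh`, `v = 2v₀ + th` with `s, t` odd, so
`u ≡ v (mod 2L)` ("`u* ≡ v* mod L`") and `(u, −u) = (v, −v) = 2`.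
[cite: GritsenkoHulekSankaran2008Proportionality, Prop. 2.4 (ii) and its proof ("If `r² = −2` and `div(r) = 2` then `u = 2u₀` …")] [cite: GritsenkoHulekSankaran2009, Prop. 3.3 (i)] -/
theorem exists_uGens_apply_eq_of_apply_self_eq_neg_two_of_forall_two_dvd (hu : B₀.IsUnimodular)
    (he : B₀.IsEven) {x y x₁ y₁ : M} (h : TwoHyperbolicPairs B₀ x y x₁ y₁) {u v : M × ℤ}
    (huu : B₀.prod ((-(2 * d : ℤ)) • LinearMap.mul ℤ ℤ) u u = -2)
    (hvv : B₀.prod ((-(2 * d : ℤ)) • LinearMap.mul ℤ ℤ) v v = -2)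
    (h2u : ∀ z, (2 : ℤ) ∣ B₀.prod ((-(2 * d : ℤ)) • LinearMap.mul ℤ ℤ) u z)
    (h2v : ∀ z, (2 : ℤ) ∣ B₀.prod ((-(2 * d : ℤ)) • LinearMap.mul ℤ ℤ) v z) :
    ∃ l : List (UGen (M × ℤ)),
      (∀ g ∈ l, g.IsAdmissible (B₀.prod ((-(2 * d : ℤ)) • LinearMap.mul ℤ ℤ)) (x, 0) (y, 0)) ∧
        UGen.eval (B₀.prod ((-(2 * d : ℤ)) • LinearMap.mul ℤ ℤ)) (x, 0) (y, 0) l u = v := by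
  obtain ⟨u₀, hu₀⟩ := exists_fst_eq_two_smul_of_forall_two_dvd d hu h2u
  obtain ⟨v₀, hv₀⟩ := exists_fst_eq_two_smul_of_forall_two_dvd d hu h2v
  obtain ⟨⟨a, ha⟩, -⟩ := odd_snd_and_mod_four_eq_one_of_forall_two_dvd d hu he huu h2u
  obtain ⟨⟨b, hb⟩, -⟩ := odd_snd_and_mod_four_eq_one_of_forall_two_dvd d hu he hvv h2v
  have hu' : B₀.prod ((-(2 * d : ℤ)) • LinearMap.mul ℤ ℤ) u (-u) = 2 := by rw [map_neg, huu]; norm_num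
  have hv' : B₀.prod ((-(2 * d : ℤ)) • LinearMap.mul ℤ ℤ) v (-v) = 2 := by rw [map_neg, hvv]; norm_num
  refine (h.inl (isSymm_smul_mul _)).exists_uGens_apply_eq_of_smul_eq_sub
    (isSymm_isEven_prod_neg_twoMul_smul_mul B₀ d h.isSymm he).2 (huu.trans hvv.symm) h2u hu' hv'
    (w := (u₀ - v₀, a - b)) (Prod.ext ?_ ?_)
  · change (2 : ℤ) • (u₀ - v₀) = u.1 - v.1
    rw [smul_sub, ← hu₀, ← hv₀]
  · change (2 : ℤ) • (a - b) = u.2 - v.2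
    rw [ha, hb, smul_eq_mul]
    ring

variable [Module.Finite ℤ M] [Module.Free ℤ M]

/-- **`E_U ⊂ Õ(L)`, so: `(−2)`-vectors with `div = 1` form one `Õ(B₀ ⊕ ⟨−2d⟩)`-orbit** — an isometry acting as the
identity on the discriminant group carries `u` to `v`. (The printed statement is for `Õ⁺`; the Eichler words lie
in `Õ⁺ ∩ S̃O` as well, but the tree has no spinor norm — TODO(general form): `Õ⁺(L_{2d}^{(m)})`-orbits.)
[cite: GritsenkoHulekSankaran2008Proportionality, Prop. 2.4 (ii) ("There is one `Õ⁺(L_{2d}^{(m)})`-orbit of `(−2)`-vectors `r` in `L_{2d}^{(m)}` with `div(r) = 1`")] [cite: GritsenkoHulekSankaran2009, §3.3 ("`E(L)` is a subgroup of `S̃O⁺(L)`")] -/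
theorem exists_isometryEquiv_apply_eq_of_apply_self_eq_neg_two_of_apply_eq_one (hu : B₀.IsUnimodular)
    (he : B₀.IsEven) (hd : 0 < d) {x y x₁ y₁ : M} (h : TwoHyperbolicPairs B₀ x y x₁ y₁) {u v u' v' : M × ℤ}
    (huu : B₀.prod ((-(2 * d : ℤ)) • LinearMap.mul ℤ ℤ) u u = -2)
    (hvv : B₀.prod ((-(2 * d : ℤ)) • LinearMap.mul ℤ ℤ) v v = -2)
    (hu' : B₀.prod ((-(2 * d : ℤ)) • LinearMap.mul ℤ ℤ) u u' = 1)
    (hv' : B₀.prod ((-(2 * d : ℤ)) • LinearMap.mul ℤ ℤ) v v' = 1) :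
    ∃ g : (B₀.prod ((-(2 * d : ℤ)) • LinearMap.mul ℤ ℤ)).IsometryEquiv (B₀.prod ((-(2 * d : ℤ)) • LinearMap.mul ℤ ℤ)),
      g.discriminantGroupCongr = LinearEquiv.refl ℤ _ ∧ g u = v := by
  obtain ⟨l, hl, hluv⟩ :=
    exists_uGens_apply_eq_of_apply_self_eq_neg_two_of_apply_eq_one d he h huu hvv hu' hv'
  have hL := h.inl (S := (-(2 * d : ℤ)) • LinearMap.mul ℤ ℤ) (isSymm_smul_mul _)
  exact ⟨UGen.evalEquiv hL.isSymm hL.xx hL.yy l hl,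
    UGen.discriminantGroupCongr_evalEquiv (nondegenerate_prod_neg_twoMul_smul_mul B₀ d hu hd) hL.isSymm hL.xx
      hL.yy l hl,
    by rw [UGen.evalEquiv_apply, hluv]⟩

/-- **`(−2)`-vectors with `div = 2` form one `Õ(B₀ ⊕ ⟨−2d⟩)`-orbit** ("If `d ≡ 1 mod 4` then there is a second orbit
of `(−2)`-vectors, with `div(r) = 2`"). TODO(general form): `Õ⁺`-orbits (no spinor norm in the tree).
[cite: GritsenkoHulekSankaran2008Proportionality, Prop. 2.4 (ii)] [cite: GritsenkoHulekSankaran2009, §3.3] -/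
theorem exists_isometryEquiv_apply_eq_of_apply_self_eq_neg_two_of_forall_two_dvd (hu : B₀.IsUnimodular)
    (he : B₀.IsEven) (hd : 0 < d) {x y x₁ y₁ : M} (h : TwoHyperbolicPairs B₀ x y x₁ y₁) {u v : M × ℤ}
    (huu : B₀.prod ((-(2 * d : ℤ)) • LinearMap.mul ℤ ℤ) u u = -2)
    (hvv : B₀.prod ((-(2 * d : ℤ)) • LinearMap.mul ℤ ℤ) v v = -2)
    (h2u : ∀ z, (2 : ℤ) ∣ B₀.prod ((-(2 * d : ℤ)) • LinearMap.mul ℤ ℤ) u z)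
    (h2v : ∀ z, (2 : ℤ) ∣ B₀.prod ((-(2 * d : ℤ)) • LinearMap.mul ℤ ℤ) v z) :
    ∃ g : (B₀.prod ((-(2 * d : ℤ)) • LinearMap.mul ℤ ℤ)).IsometryEquiv (B₀.prod ((-(2 * d : ℤ)) • LinearMap.mul ℤ ℤ)),
      g.discriminantGroupCongr = LinearEquiv.refl ℤ _ ∧ g u = v := by
  obtain ⟨l, hl, hluv⟩ :=
    exists_uGens_apply_eq_of_apply_self_eq_neg_two_of_forall_two_dvd d hu he h huu hvv h2u h2v
  have hL := h.inl (S := (-(2 * d : ℤ)) • LinearMap.mul ℤ ℤ) (isSymm_smul_mul _)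
  exact ⟨UGen.evalEquiv hL.isSymm hL.xx hL.yy l hl,
    UGen.discriminantGroupCongr_evalEquiv (nondegenerate_prod_neg_twoMul_smul_mul B₀ d hu hd) hL.isSymm hL.xx
      hL.yy l hl,
    by rw [UGen.evalEquiv_apply, hluv]⟩

end Abstract

/-! #### The divisor is an isometry invariant; the orbit count -/

section Count

/-- Isometries preserve divisibility of the products: `n ∣ (g r, z)` for all `z` iff `n ∣ (r, z)` for all `z`
(so `div(r)` is an `O(L)`-invariant). [cite: GritsenkoHulekSankaran2008Proportionality, §2 ("the divisor `div(r)` of `r ∈ L` … the positive generator of the ideal `(l, L)`")] -/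
theorem forall_dvd_apply_iff_of_isometryEquiv {W₁ W₂ : Type*} [AddCommGroup W₁] [AddCommGroup W₂]
    {B₁ : BilinForm ℤ W₁} {B₂ : BilinForm ℤ W₂} (g : B₁.IsometryEquiv B₂) (r : W₁) (n : ℤ) :
    (∀ z, n ∣ B₂ (g r) z) ↔ ∀ z, n ∣ B₁ r z := by
  constructor
  · intro hz z
    rw [← g.map_app]
    exact hz (g z)
  · intro hz z
    have h1 : B₂ (g r) z = B₁ r (g.symm z) := by
      rw [← g.map_app]
      exact congrArg (B₂ (g r)) (g.toLinearEquiv.apply_symm_apply z).symm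
    rw [h1]
    exact hz _

/-- Isometries preserve the existence of a vector with prescribed product: `(g r, z) = n` is soluble iff `(r, z) = n`
is (so "`div(r) = 1`" is an `O(L)`-invariant). [cite: GritsenkoHulekSankaran2008Proportionality, §2] -/
theorem exists_apply_eq_iff_of_isometryEquiv {W₁ W₂ : Type*} [AddCommGroup W₁] [AddCommGroup W₂]
    {B₁ : BilinForm ℤ W₁} {B₂ : BilinForm ℤ W₂} (g : B₁.IsometryEquiv B₂) (r : W₁) (n : ℤ) :
    (∃ z, B₂ (g r) z = n) ↔ ∃ z, B₁ r z = n := by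
  constructor
  · rintro ⟨z, hz⟩
    refine ⟨g.symm z, ?_⟩
    rw [← g.map_app, ← hz]
    exact congrArg (B₂ (g r)) (g.toLinearEquiv.apply_symm_apply z)
  · rintro ⟨z, hz⟩
    exact ⟨g z, by rw [g.map_app, hz]⟩

/-- Counting classes: if a relation `R` on `S` identifies exactly the points with the same value of a predicate `P`,
`¬P` is inhabited and `P` is inhabited iff `c`, then `S/R` has `2` elements if `c` and `1` otherwise ("the
`(−2)`-vectors form two possible orbits of vectors with divisor equal to `1` or `2`").
[cite: GritsenkoHulekSankaran2008Proportionality, Prop. 2.4 (ii) proof] -/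
private theorem natCard_quot_eq_ite {S : Type*} (R : S → S → Prop) (P : S → Prop)
    (h1 : ∀ r s, R r s → (P r ↔ P s)) (h2 : ∀ r s, (P r ↔ P s) → R r s) (h3 : ∃ r, ¬ P r) (c : Prop)
    [Decidable c] (h4 : (∃ r, P r) ↔ c) : Nat.card (Quot R) = if c then 2 else 1 := by
  classical
  obtain ⟨r₀, hr₀⟩ := h3
  split_ifs with hc
  · obtain ⟨r₁, hr₁⟩ := h4.2 hc
    let f : Quot R → Bool := Quot.lift (fun r ↦ decide (P r)) fun r s hrs ↦ by rw [decide_eq_decide.2 (h1 r s hrs)]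
    have hf : Function.Bijective f := by
      refine ⟨fun a b ↦ ?_, fun b ↦ ?_⟩
      · induction a using Quot.ind
        induction b using Quot.ind
        intro hab
        exact Quot.sound (h2 _ _ (decide_eq_decide.1 hab))
      · cases b
        · exact ⟨Quot.mk R r₀, by simp [f, hr₀]⟩
        · exact ⟨Quot.mk R r₁, by simp [f, hr₁]⟩
    rw [Nat.card_eq_of_bijective f hf, Nat.card_eq_fintype_card, Fintype.card_bool]
  · have hP : ∀ r, ¬ P r := fun r hr ↦ hc (h4.1 ⟨r, hr⟩)
    haveI : Subsingleton (Quot R) := ⟨fun a b ↦ by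
      induction a using Quot.ind
      induction b using Quot.ind
      exact Quot.sound (h2 _ _ (iff_of_false (hP _) (hP _)))⟩
    haveI : Nonempty (Quot R) := ⟨Quot.mk R r₀⟩
    exact Nat.card_eq_one_iff_unique.2 ⟨inferInstance, inferInstance⟩

variable {M : Type u} [AddCommGroup M] [Module.Finite ℤ M] [Module.Free ℤ M] {B₀ : BilinForm ℤ M} (d : ℕ)

/-- **GHS Prop. 2.4 (ii), the orbit count under `O(L)`**: for `L = B₀ ⊕ ⟨−2d⟩` (`B₀` even unimodular with two
orthogonal hyperbolic planes, `d ≥ 1`) the `(−2)`-vectors of `L` form exactly two `O(L)`-orbits if `d ≡ 1 (mod 4)`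
(divisors `1` and `2`) and exactly one otherwise. [cite: GritsenkoHulekSankaran2008Proportionality, Prop. 2.4 (ii)] -/
theorem natCard_quot_isometryEquiv_apply_self_eq_neg_two (hu : B₀.IsUnimodular) (he : B₀.IsEven) (hd : 0 < d)
    {x y x₁ y₁ : M} (h : TwoHyperbolicPairs B₀ x y x₁ y₁) :
    Nat.card (Quot fun r s : {r : M × ℤ // B₀.prod ((-(2 * d : ℤ)) • LinearMap.mul ℤ ℤ) r r = -2} ↦
      ∃ g : (B₀.prod ((-(2 * d : ℤ)) • LinearMap.mul ℤ ℤ)).IsometryEquiv (B₀.prod ((-(2 * d : ℤ)) • LinearMap.mul ℤ ℤ)),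
        g r.1 = s.1) = if d % 4 = 1 then 2 else 1 := by
  refine natCard_quot_eq_ite _ (fun r ↦ ∀ z, (2 : ℤ) ∣ B₀.prod ((-(2 * d : ℤ)) • LinearMap.mul ℤ ℤ) r.1 z)
    ?_ ?_ ?_ _ ?_
  · rintro r s ⟨g, hg⟩
    rw [← hg, forall_dvd_apply_iff_of_isometryEquiv]
  · rintro ⟨r, hr⟩ ⟨s, hs⟩ hrs
    dsimp only at hrs ⊢
    by_cases hP : ∀ z, (2 : ℤ) ∣ B₀.prod ((-(2 * d : ℤ)) • LinearMap.mul ℤ ℤ) r z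
    · obtain ⟨g, -, hg⟩ := exists_isometryEquiv_apply_eq_of_apply_self_eq_neg_two_of_forall_two_dvd d hu he hd h
        hr hs hP (hrs.1 hP)
      exact ⟨g, hg⟩
    · obtain ⟨r', hr'⟩ := (exists_apply_eq_one_or_forall_two_dvd_of_apply_self_eq_neg_two _ hr).resolve_right hP
      obtain ⟨s', hs'⟩ := (exists_apply_eq_one_or_forall_two_dvd_of_apply_self_eq_neg_two _ hs).resolve_right
        fun hQ ↦ hP (hrs.2 hQ)
      obtain ⟨g, -, hg⟩ := exists_isometryEquiv_apply_eq_of_apply_self_eq_neg_two_of_apply_eq_one d hu he hd h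
        hr hs hr' hs'
      exact ⟨g, hg⟩
  · obtain ⟨r, r', hr, hr'⟩ := exists_apply_self_eq_neg_two_and_apply_eq_one (B₀ := B₀) d h
    refine ⟨⟨r, hr⟩, fun hP ↦ ?_⟩
    have h2 := hP r'
    rw [hr'] at h2
    norm_num at h2
  · constructor
    · rintro ⟨⟨r, hr⟩, hP⟩
      exact (odd_snd_and_mod_four_eq_one_of_forall_two_dvd d hu he hr hP).2
    · intro hd4
      obtain ⟨r, -, hr, -, hP⟩ := exists_apply_self_eq_neg_two_and_forall_two_dvd (B₀ := B₀) d h hd4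
      exact ⟨⟨r, hr⟩, hP⟩

/-- **GHS Prop. 2.4 (ii), the orbit count under `Õ(L)`** (isometries acting as the identity on `A_L`): the
`(−2)`-vectors of `L = B₀ ⊕ ⟨−2d⟩` form two `Õ(L)`-orbits if `d ≡ 1 (mod 4)` and one otherwise — "There is one
`Õ⁺(L_{2d}^{(m)})`-orbit of `(−2)`-vectors `r` in `L_{2d}^{(m)}` with `div(r) = 1`. If `d ≡ 1 mod 4` then there is
a second orbit of `(−2)`-vectors, with `div(r) = 2`." TODO(general form): the same for `Õ⁺` (spinor norm).
[cite: GritsenkoHulekSankaran2008Proportionality, Prop. 2.4 (ii)] -/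
theorem natCard_quot_stable_isometryEquiv_apply_self_eq_neg_two (hu : B₀.IsUnimodular) (he : B₀.IsEven)
    (hd : 0 < d) {x y x₁ y₁ : M} (h : TwoHyperbolicPairs B₀ x y x₁ y₁) :
    Nat.card (Quot fun r s : {r : M × ℤ // B₀.prod ((-(2 * d : ℤ)) • LinearMap.mul ℤ ℤ) r r = -2} ↦
      ∃ g : (B₀.prod ((-(2 * d : ℤ)) • LinearMap.mul ℤ ℤ)).IsometryEquiv (B₀.prod ((-(2 * d : ℤ)) • LinearMap.mul ℤ ℤ)),
        g.discriminantGroupCongr = LinearEquiv.refl ℤ _ ∧ g r.1 = s.1) = if d % 4 = 1 then 2 else 1 := by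
  refine natCard_quot_eq_ite _ (fun r ↦ ∀ z, (2 : ℤ) ∣ B₀.prod ((-(2 * d : ℤ)) • LinearMap.mul ℤ ℤ) r.1 z)
    ?_ ?_ ?_ _ ?_
  · rintro r s ⟨g, -, hg⟩
    rw [← hg, forall_dvd_apply_iff_of_isometryEquiv]
  · rintro ⟨r, hr⟩ ⟨s, hs⟩ hrs
    dsimp only at hrs ⊢
    by_cases hP : ∀ z, (2 : ℤ) ∣ B₀.prod ((-(2 * d : ℤ)) • LinearMap.mul ℤ ℤ) r z
    · exact exists_isometryEquiv_apply_eq_of_apply_self_eq_neg_two_of_forall_two_dvd d hu he hd h hr hs hP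
        (hrs.1 hP)
    · obtain ⟨r', hr'⟩ := (exists_apply_eq_one_or_forall_two_dvd_of_apply_self_eq_neg_two _ hr).resolve_right hP
      obtain ⟨s', hs'⟩ := (exists_apply_eq_one_or_forall_two_dvd_of_apply_self_eq_neg_two _ hs).resolve_right
        fun hQ ↦ hP (hrs.2 hQ)
      exact exists_isometryEquiv_apply_eq_of_apply_self_eq_neg_two_of_apply_eq_one d hu he hd h hr hs hr' hs'
  · obtain ⟨r, r', hr, hr'⟩ := exists_apply_self_eq_neg_two_and_apply_eq_one (B₀ := B₀) d h
    refine ⟨⟨r, hr⟩, fun hP ↦ ?_⟩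
    have h2 := hP r'
    rw [hr'] at h2
    norm_num at h2
  · constructor
    · rintro ⟨⟨r, hr⟩, hP⟩
      exact (odd_snd_and_mod_four_eq_one_of_forall_two_dvd d hu he hr hP).2
    · intro hd4
      obtain ⟨r, -, hr, -, hP⟩ := exists_apply_self_eq_neg_two_and_forall_two_dvd (B₀ := B₀) d h hd4
      exact ⟨⟨r, hr⟩, hP⟩

end Count

/-! ### §2 Prop. 2.4 (i): `(−2)`-vectors of an even unimodular lattice with `n± ≥ 2` -/

section Unimodular

variable {V : Type*} [AddCommGroup V] (Q : BilinForm ℤ V)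

/-- **`(−2)`-vectors are primitive**: in an even lattice on a torsion-free module, `r² = −2` spans a saturated
line (`kw = ar` gives `k²·w² = −2a²` with `w²` even, so `k² ∣ a²`, `k ∣ a`, `w ∈ ℤr`).
[cite: GritsenkoHulekSankaran2008Proportionality, §2 proof of Prop. 2.4 ("If `u` is a primitive vector of an even unimodular lattice `II_{2,8m+2}` then `div(u) = 1`")] [cite: Huybrechts2016K3, Ch. 14 §0.2 (primitive vectors)] -/
theorem mem_span_singleton_of_smul_mem_of_apply_self_eq_neg_two [Module.IsTorsionFree ℤ V] (he : Q.IsEven)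
    {r : V} (hr : Q r r = -2) (k : ℤ) (w : V) (hk : k ≠ 0) (hw : k • w ∈ ℤ ∙ r) : w ∈ ℤ ∙ r := by
  obtain ⟨a, ha⟩ := Submodule.mem_span_singleton.1 hw
  obtain ⟨j, hj⟩ := he w
  -- `k² w² = a² r²`
  have h1 : k * k * Q w w = a * a * Q r r := by
    have h2 := congrArg (fun v ↦ Q v v) ha
    simp only [map_zsmul, LinearMap.smul_apply, smul_eq_mul] at h2
    linarith
  rw [hr, hj] at h1
  have h3 : k ^ 2 ∣ a ^ 2 := ⟨-j, by linarith⟩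
  obtain ⟨b, rfl⟩ := (Int.pow_dvd_pow_iff two_ne_zero).1 h3
  have h4 : k • (w - b • r) = 0 := by rw [smul_sub, smul_smul, ha, sub_self]
  rw [smul_eq_zero_iff_right hk, sub_eq_zero] at h4
  exact Submodule.mem_span_singleton.2 ⟨b, h4.symm⟩

/-- A `(−2)`-vector is nonzero. [cite: GritsenkoHulekSankaran2008Proportionality, §2] -/
theorem ne_zero_of_apply_self_eq_neg_two {r : V} (hr : Q r r = -2) : r ≠ 0 := by
  rintro rfl
  simp at hr

variable [Module.Finite ℤ V] [Module.Free ℤ V]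

/-- **Prop. 2.4 (i), transitivity: "Any two `(−2)`-vectors in the lattice `II_{2,8m+2}` are equivalent modulo
`O⁺(II_{2,8m+2})`"** — here for every symmetric even unimodular lattice with `n± ≥ 2` (so `≃ E₈(±1)^{⊕m} ⊕ U^{⊕k}`,
`k ≥ 2`) and modulo `O`: `(−2)`-vectors are primitive of the same square, and Huybrechts' Cor. 14.1.10 applies (the
isometry is again an Eichler word). TODO(general form): `O⁺` (no spinor norm ∕ orientation character in the tree).
[cite: GritsenkoHulekSankaran2008Proportionality, Prop. 2.4 (i)] [cite: Huybrechts2016K3, Ch. 14 Cor. 1.10] -/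
theorem exists_isometryEquiv_apply_eq_of_apply_self_eq_neg_two (hs : Q.IsSymm) (hu : Q.IsUnimodular)
    (he : Q.IsEven) (h2 : 2 ≤ sigPos Q.toQuadraticMap) (h2' : 2 ≤ sigNeg Q.toQuadraticMap) {r s : V}
    (hr : Q r r = -2) (hs' : Q s s = -2) : ∃ φ : Q.IsometryEquiv Q, φ r = s := by
  haveI : Q.IsPerfPair := hu
  obtain ⟨z, hz⟩ := exists_apply_eq_one_of_primitive (B := Q) (ne_zero_of_apply_self_eq_neg_two Q hr)
    (mem_span_singleton_of_smul_mem_of_apply_self_eq_neg_two Q he hr)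
  obtain ⟨z', hz'⟩ := exists_apply_eq_one_of_primitive (B := Q) (ne_zero_of_apply_self_eq_neg_two Q hs')
    (mem_span_singleton_of_smul_mem_of_apply_self_eq_neg_two Q he hs')
  exact exists_isometryEquiv_apply_eq_of_apply_eq_one Q hs hu he h2 h2' (hr.trans hs'.symm) hz hz'

/-- **Prop. 2.4 (i), one orbit**: the `(−2)`-vectors of a symmetric even unimodular lattice with `n± ≥ 2` form a
single `O`-orbit (`II_{2,8m+2} = 2U ⊕ mE₈(−1)` is the printed case).
[cite: GritsenkoHulekSankaran2008Proportionality, Prop. 2.4 (i)] [cite: Huybrechts2016K3, Ch. 14 Cor. 1.10] -/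
theorem natCard_quot_isometryEquiv_apply_self_eq_neg_two_of_isUnimodular (hs : Q.IsSymm) (hu : Q.IsUnimodular)
    (he : Q.IsEven) (h2 : 2 ≤ sigPos Q.toQuadraticMap) (h2' : 2 ≤ sigNeg Q.toQuadraticMap) :
    Nat.card (Quot fun r s : {r : V // Q r r = -2} ↦ ∃ φ : Q.IsometryEquiv Q, φ r.1 = s.1) = 1 := by
  -- a `(−2)`-vector exists: `e − f` in one of the (at least two) hyperbolic planes
  obtain ⟨x, y, x₁, y₁, h⟩ := exists_twoHyperbolicPairs_of_isEven_of_isUnimodular Q hs hu he h2 h2'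
  have hr : Q (x - y) (x - y) = -2 := by
    simp only [map_sub, LinearMap.sub_apply, h.xx, h.yy, h.xy, h.isSymm.eq y x]
    ring
  haveI : Nonempty (Quot fun r s : {r : V // Q r r = -2} ↦ ∃ φ : Q.IsometryEquiv Q, φ r.1 = s.1) :=
    ⟨Quot.mk _ ⟨x - y, hr⟩⟩
  haveI : Subsingleton (Quot fun r s : {r : V // Q r r = -2} ↦ ∃ φ : Q.IsometryEquiv Q, φ r.1 = s.1) :=
    ⟨by
      rintro ⟨a⟩ ⟨b⟩
      exact Quot.sound (exists_isometryEquiv_apply_eq_of_apply_self_eq_neg_two Q hs hu he h2 h2' a.2 b.2)⟩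
  exact Nat.card_eq_one_iff_unique.2 ⟨inferInstance, inferInstance⟩

/-- **Prop. 2.4 (i), the orthogonal complement: "the orthogonal complement of a `(−2)`-vector `r` is isometric to
`K_{II}^{(m)} = U ⊕ mE₈(−1) ⊕ ⟨2⟩`"** — for every symmetric even unimodular lattice with `n± ≥ 2` and `σ ≤ 0`:
`r^⊥ ≃ E₈(−1)^{⊕m} ⊕ U^{⊕k} ⊕ ⟨2⟩` with `σ = −8m`, `n₊ = k + 1` (the printed `II_{2,8m+2}`: `k = 1`); Huybrechts'
Example 14.1.11 (i) with `2d = −2`. [cite: GritsenkoHulekSankaran2008Proportionality, Prop. 2.4 (i)] [cite: Huybrechts2016K3, Ch. 14 Example 1.11 (i)] -/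
theorem restrict_orthogonal_equivalent_of_apply_self_eq_neg_two_of_signature_nonpos (hs : Q.IsSymm)
    (hu : Q.IsUnimodular) (he : Q.IsEven) (h2 : 2 ≤ sigPos Q.toQuadraticMap) (h2' : 2 ≤ sigNeg Q.toQuadraticMap)
    (hσ : Q.signature ≤ 0) {r : V} (hr : Q r r = -2) :
    ∃ m k : ℕ, Q.signature = -(8 * m) ∧ sigPos Q.toQuadraticMap = k + 1 ∧
      (Q.restrict (Q.orthogonal (ℤ ∙ r))).Equivalent
        ((((LinearMap.BilinForm.pi fun _ : Fin m ↦ -e8Form).prod (hyperbolicSum k)).prod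
          ((2 : ℤ) • LinearMap.mul ℤ ℤ))) := by
  obtain ⟨m, k, hm, hk, hE⟩ := restrict_orthogonal_equivalent_of_primitive_of_signature_nonpos Q hs hu he h2 h2'
    hσ (d := -1) (by rw [hr]; norm_num) (ne_zero_of_apply_self_eq_neg_two Q hr)
    (mem_span_singleton_of_smul_mem_of_apply_self_eq_neg_two Q he hr)
  refine ⟨m, k, hm, hk, ?_⟩
  have h1 : (-(2 * (-1 : ℤ))) = 2 := by norm_num
  rw [h1] at hE
  exact hE

/-- The same for `σ ≥ 0`: `r^⊥ ≃ E₈^{⊕m} ⊕ U^{⊕k} ⊕ ⟨2⟩` with `σ = 8m`, `n₋ = k + 1`.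
[cite: GritsenkoHulekSankaran2008Proportionality, Prop. 2.4 (i)] [cite: Huybrechts2016K3, Ch. 14 Example 1.11 (i)] -/
theorem restrict_orthogonal_equivalent_of_apply_self_eq_neg_two_of_signature_nonneg (hs : Q.IsSymm)
    (hu : Q.IsUnimodular) (he : Q.IsEven) (h2 : 2 ≤ sigPos Q.toQuadraticMap) (h2' : 2 ≤ sigNeg Q.toQuadraticMap)
    (hσ : 0 ≤ Q.signature) {r : V} (hr : Q r r = -2) :
    ∃ m k : ℕ, Q.signature = 8 * m ∧ sigNeg Q.toQuadraticMap = k + 1 ∧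
      (Q.restrict (Q.orthogonal (ℤ ∙ r))).Equivalent
        ((((LinearMap.BilinForm.pi fun _ : Fin m ↦ e8Form).prod (hyperbolicSum k)).prod
          ((2 : ℤ) • LinearMap.mul ℤ ℤ))) := by
  obtain ⟨m, k, hm, hk, hE⟩ := restrict_orthogonal_equivalent_of_primitive Q hs hu he h2 h2' hσ (d := -1)
    (by rw [hr]; norm_num) (ne_zero_of_apply_self_eq_neg_two Q hr)
    (mem_span_singleton_of_smul_mem_of_apply_self_eq_neg_two Q he hr)
  refine ⟨m, k, hm, hk, ?_⟩
  have h1 : (-(2 * (-1 : ℤ))) = 2 := by norm_num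
  rw [h1] at hE
  exact hE

end Unimodular

/-! ### §3 The model `L_{2d}^{(m)} = (E₈(−1)^{⊕m} ⊕ U^{⊕2}) ⊕ ℤ(−2d)`: orbits and the complements `K_{2d}^{(m)}`, `N_{2d}^{(m)}` -/

section Model

variable (m d : ℕ)

/-- `E₈(−1)^{⊕m} ⊕ U^{⊕2}` is symmetric, even and unimodular. [cite: GritsenkoHulekSankaran2008Proportionality, §2 ("`II_{2,8m+2} = 2U ⊕ mE₈(−1)`")] -/
theorem isSymm_isEven_isUnimodular_pi_neg_e8Form_prod_hyperbolicSum_two :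
    ((LinearMap.BilinForm.pi fun _ : Fin m ↦ -e8Form).prod (hyperbolicSum 2)).IsSymm ∧
      ((LinearMap.BilinForm.pi fun _ : Fin m ↦ -e8Form).prod (hyperbolicSum 2)).IsEven ∧
        ((LinearMap.BilinForm.pi fun _ : Fin m ↦ -e8Form).prod (hyperbolicSum 2)).IsUnimodular := by
  obtain ⟨hsP, heP, huP⟩ := isSymm_isEven_isUnimodular_pi_neg_e8Form (m := m)
  exact ⟨hsP.prod (isSymm_hyperbolicSum 2), isEven_prod_iff.2 ⟨heP, isEven_hyperbolicSum 2⟩,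
    isUnimodular_prod_iff.2 ⟨huP, isUnimodular_hyperbolicSum 2⟩⟩

/-- The two hyperbolic planes `(e₁, f₁), (e₂, f₂)` of `E₈(−1)^{⊕m} ⊕ U^{⊕2}`.
[cite: GritsenkoHulekSankaran2008Proportionality, §2 proof of Prop. 2.4 ("If the lattice `L` contains two hyperbolic planes …")] -/
theorem twoHyperbolicPairs_pi_neg_e8Form_prod_hyperbolicSum_two :
    TwoHyperbolicPairs ((LinearMap.BilinForm.pi fun _ : Fin m ↦ -e8Form).prod (hyperbolicSum 2))
      (0, (Pi.single 0 1, 0)) (0, (0, Pi.single 0 1)) (0, (Pi.single 1 1, 0)) (0, (0, Pi.single 1 1)) :=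
  TwoHyperbolicPairs.inr (IsSymm.pi fun _ ↦ isSymm_e8Form.neg) (twoHyperbolicPairs_hyperbolicSum (by decide))

/-- **GHS Prop. 2.4 (ii) for `L_{2d}^{(m)}`, `O`-orbits**: the `(−2)`-vectors of
`L_{2d}^{(m)} = (E₈(−1)^{⊕m} ⊕ U^{⊕2}) ⊕ ℤ(−2d)` (`d ≥ 1`; `m = 2` is the K3 case `L_{2d}`) form two `O(L_{2d}^{(m)})`-orbits
if `d ≡ 1 (mod 4)` and one otherwise. [cite: GritsenkoHulekSankaran2008Proportionality, Prop. 2.4 (ii)] -/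
theorem natCard_quot_isometryEquiv_latticeL2dm_apply_self_eq_neg_two (hd : 0 < d) :
    Nat.card (Quot fun r s : {r : ((Fin m → Fin 8 → ℤ) × ((Fin 2 → ℤ) × (Fin 2 → ℤ))) × ℤ //
        (((LinearMap.BilinForm.pi fun _ : Fin m ↦ -e8Form).prod (hyperbolicSum 2)).prod
          ((-(2 * d : ℤ)) • LinearMap.mul ℤ ℤ)) r r = -2} ↦
      ∃ g : ((((LinearMap.BilinForm.pi fun _ : Fin m ↦ -e8Form).prod (hyperbolicSum 2)).prod
          ((-(2 * d : ℤ)) • LinearMap.mul ℤ ℤ))).IsometryEquiv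
          ((((LinearMap.BilinForm.pi fun _ : Fin m ↦ -e8Form).prod (hyperbolicSum 2)).prod
          ((-(2 * d : ℤ)) • LinearMap.mul ℤ ℤ))), g r.1 = s.1) = if d % 4 = 1 then 2 else 1 := by
  obtain ⟨-, heB, huB⟩ := isSymm_isEven_isUnimodular_pi_neg_e8Form_prod_hyperbolicSum_two m
  exact natCard_quot_isometryEquiv_apply_self_eq_neg_two d huB heB hd
    (twoHyperbolicPairs_pi_neg_e8Form_prod_hyperbolicSum_two m)

/-- **GHS Prop. 2.4 (ii) for `L_{2d}^{(m)}`, `Õ`-orbits**: "There is one `Õ⁺(L_{2d}^{(m)})`-orbit of `(−2)`-vectors `r`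
in `L_{2d}^{(m)}` with `div(r) = 1`. If `d ≡ 1 mod 4` then there is a second orbit of `(−2)`-vectors, with
`div(r) = 2`" — here for `Õ` (TODO(general form): `Õ⁺`). [cite: GritsenkoHulekSankaran2008Proportionality, Prop. 2.4 (ii)] -/
theorem natCard_quot_stable_isometryEquiv_latticeL2dm_apply_self_eq_neg_two (hd : 0 < d) :
    Nat.card (Quot fun r s : {r : ((Fin m → Fin 8 → ℤ) × ((Fin 2 → ℤ) × (Fin 2 → ℤ))) × ℤ //
        (((LinearMap.BilinForm.pi fun _ : Fin m ↦ -e8Form).prod (hyperbolicSum 2)).prod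
          ((-(2 * d : ℤ)) • LinearMap.mul ℤ ℤ)) r r = -2} ↦
      ∃ g : ((((LinearMap.BilinForm.pi fun _ : Fin m ↦ -e8Form).prod (hyperbolicSum 2)).prod
          ((-(2 * d : ℤ)) • LinearMap.mul ℤ ℤ))).IsometryEquiv
          ((((LinearMap.BilinForm.pi fun _ : Fin m ↦ -e8Form).prod (hyperbolicSum 2)).prod
          ((-(2 * d : ℤ)) • LinearMap.mul ℤ ℤ))),
        g.discriminantGroupCongr = LinearEquiv.refl ℤ _ ∧ g r.1 = s.1) = if d % 4 = 1 then 2 else 1 := by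
  obtain ⟨-, heB, huB⟩ := isSymm_isEven_isUnimodular_pi_neg_e8Form_prod_hyperbolicSum_two m
  exact natCard_quot_stable_isometryEquiv_apply_self_eq_neg_two d huB heB hd
    (twoHyperbolicPairs_pi_neg_e8Form_prod_hyperbolicSum_two m)

/-! #### The orthogonal complements -/

/-- **`(v, 0)^⊥ = v^⊥ ⊕ Λ₂`** in `Λ₁ ⊕ Λ₂`, as bilinear modules (companion of the tree's `(0, v)^⊥ = Λ₁ ⊕ v^⊥`).
[cite: Serre1973, Ch. V §1.2] [cite: GritsenkoHulekSankaran2008Proportionality, Prop. 2.4 (ii) proof ("Elementary calculation gives us the orthogonal complement of `r`")] -/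
theorem restrict_orthogonal_prod_zero_equivalent {M₁ N₁ : Type*} [AddCommGroup M₁] [AddCommGroup N₁]
    (R' : BilinForm ℤ M₁) (S : BilinForm ℤ N₁) (v : M₁) :
    ((R'.prod S).restrict ((R'.prod S).orthogonal (ℤ ∙ (v, (0 : N₁))))).Equivalent
      ((R'.restrict (R'.orthogonal (ℤ ∙ v))).prod S) := by
  have key : ∀ p : M₁ × N₁, p ∈ (R'.prod S).orthogonal (ℤ ∙ (v, (0 : N₁))) ↔ p.1 ∈ R'.orthogonal (ℤ ∙ v) := by
    intro p
    rw [(R'.prod S).mem_orthogonal_span_singleton_iff, R'.mem_orthogonal_span_singleton_iff,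
      LinearMap.BilinForm.prod_apply]
    simp
  exact ⟨{ toFun := fun p ↦ (⟨p.1.1, (key p.1).1 p.2⟩, p.1.2)
           invFun := fun q ↦ ⟨((q.1 : M₁), q.2), (key _).2 q.1.2⟩
           map_add' := fun _ _ ↦ rfl
           map_smul' := fun _ _ ↦ rfl
           left_inv := fun _ ↦ rfl
           right_inv := fun _ ↦ rfl
           map_app' := fun _ _ ↦ rfl }⟩

/-- Evaluation of `U ⊕ ⟨−2d⟩`. [cite: GritsenkoHulekSankaran2008Proportionality, Prop. 2.4 (ii) proof ("the sublattice `U ⊕ ⟨−2d⟩`")] -/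
theorem hyperbolicForm_prod_neg_twoMul_smul_mul_apply (p q : (Fin 2 → ℤ) × ℤ) :
    hyperbolicForm.prod ((-(2 * d : ℤ)) • LinearMap.mul ℤ ℤ) p q = p.1 0 * q.1 1 + p.1 1 * q.1 0 - 2 * d * (p.2 * q.2) := by
  rw [LinearMap.BilinForm.prod_apply, hyperbolicForm_apply, smul_mul_apply]
  ring

/-- In `U ⊕ ⟨−2d⟩`: `w = w₀e + w₁f + th ⊥ 2e + 2kf + h` iff `w₁ = dt − kw₀`.
[cite: GritsenkoHulekSankaran2008Proportionality, Prop. 2.4 (ii) proof ("Elementary calculation gives us the orthogonal complement of `r`")] -/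
theorem mem_orthogonal_span_two_twoMul_one_iff (k : ℤ) (w : (Fin 2 → ℤ) × ℤ) :
    w ∈ (hyperbolicForm.prod ((-(2 * d : ℤ)) • LinearMap.mul ℤ ℤ)).orthogonal
        (ℤ ∙ ((![2, 2 * k] : Fin 2 → ℤ), (1 : ℤ))) ↔ w.1 1 = d * w.2 - k * w.1 0 := by
  rw [(hyperbolicForm.prod ((-(2 * d : ℤ)) • LinearMap.mul ℤ ℤ)).mem_orthogonal_span_singleton_iff,
    hyperbolicForm_prod_neg_twoMul_smul_mul_apply]
  simp only [Matrix.cons_val_zero, Matrix.cons_val_one]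
  constructor <;> intro h <;> linarith

/-- Evaluation of the rank-`2` form `(2 1 ∕ 1 −2k)`. [cite: GritsenkoHulekSankaran2007HM, §4.6.2 ("`N_{2d}^{(m)} = U ⊕ mE₈(−1) ⊕ (2 1 ∕ 1 (1−d)∕2)`")] -/
theorem toBilin'_two_one_one_neg_twoMul_apply (k : ℤ) (p q : Fin 2 → ℤ) :
    Matrix.toBilin' !![2, 1; 1, -(2 * k)] p q = p 0 * (2 * q 0 + q 1) + p 1 * (q 0 - 2 * k * q 1) := by
  rw [Matrix.toBilin'_apply]
  simp only [Fin.sum_univ_two, Matrix.of_apply, Matrix.cons_val', Matrix.cons_val_zero, Matrix.cons_val_one,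
    Matrix.empty_val', Matrix.cons_val_fin_one]
  ring

/-- **"Elementary calculation", `div(r) = 2`**: in `U ⊕ ⟨−2d⟩` with `d = 4k + 1`, the orthogonal complement of the
`(−2)`-vector `r = 2e + 2kf + h` has basis `w₁ = 2e + (2k+1)f + h`, `w₂ = e − kf` with Gram matrix
`(2 1 ∕ 1 −2k) = (2 1 ∕ 1 (1−d)∕2)`. The Doc. Math. 13 text prints this block as `(1 2 ∕ (1−d)∕2 1)`, which is not
symmetric; the symmetric Gram matrix `(2 1 ∕ 1 (1−d)∕2)` (determinant `−d`) printed in GHS, Doc. Math. 12 (2007)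
§4.6.2 for the same lattice `N_{2d}^{(m)}` is the one meant and proved. [cite: GritsenkoHulekSankaran2008Proportionality, Prop. 2.4 (ii)] [cite: GritsenkoHulekSankaran2007HM, §4.6.2 ("`N_{2d}^{(m)} = U ⊕ mE₈(−1) ⊕ (2 1 ∕ 1 (1−d)∕2)`")] -/
theorem restrict_orthogonal_hyperbolicForm_prod_neg_twoMul_smul_mul_equivalent {k : ℤ} (hk : (d : ℤ) = 4 * k + 1) :
    ((hyperbolicForm.prod ((-(2 * d : ℤ)) • LinearMap.mul ℤ ℤ)).restrict
        ((hyperbolicForm.prod ((-(2 * d : ℤ)) • LinearMap.mul ℤ ℤ)).orthogonal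
          (ℤ ∙ ((![2, 2 * k] : Fin 2 → ℤ), (1 : ℤ))))).Equivalent
      (Matrix.toBilin' !![2, 1; 1, -(2 * k)]) := by
  let f : (Fin 2 → ℤ) ≃ₗ[ℤ] (hyperbolicForm.prod ((-(2 * d : ℤ)) • LinearMap.mul ℤ ℤ)).orthogonal
      (ℤ ∙ ((![2, 2 * k] : Fin 2 → ℤ), (1 : ℤ))) :=
    { toFun := fun p ↦ ⟨(![2 * p 0 + p 1, (d - 2 * k) * p 0 - k * p 1], p 0),
        (mem_orthogonal_span_two_twoMul_one_iff d k _).2 (by simp; ring)⟩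
      invFun := fun w ↦ ![w.1.2, w.1.1 0 - 2 * w.1.2]
      map_add' := fun p q ↦ by
        ext i
        · fin_cases i <;> simp <;> ring
        · simp
      map_smul' := fun c p ↦ by
        ext i
        · fin_cases i <;> simp <;> ring
        · simp
      left_inv := fun p ↦ by
        ext i
        fin_cases i <;> simp
      right_inv := fun w ↦ by
        have hw := (mem_orthogonal_span_two_twoMul_one_iff d k w.1).1 w.2
        ext i
        · fin_cases i
          · simp
          · simp only [Fin.mk_one, Matrix.cons_val_one, Matrix.cons_val_zero]
            rw [hw]
            ring
        · simp }
  have hf : ∀ p, (f p : (Fin 2 → ℤ) × ℤ) = (![2 * p 0 + p 1, (d - 2 * k) * p 0 - k * p 1], p 0) := fun p ↦ rfl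
  refine Equivalent.symm ⟨{ f with map_app' := fun p q ↦ ?_ }⟩
  change hyperbolicForm.prod ((-(2 * d : ℤ)) • LinearMap.mul ℤ ℤ) (f p : (Fin 2 → ℤ) × ℤ) (f q : (Fin 2 → ℤ) × ℤ) =
    Matrix.toBilin' !![2, 1; 1, -(2 * k)] p q
  rw [hyperbolicForm_prod_neg_twoMul_smul_mul_apply, hf, hf, toBilin'_two_one_one_neg_twoMul_apply]
  simp only [Matrix.cons_val_zero, Matrix.cons_val_one]
  linear_combination (2 * p 0 * q 0 + p 0 * q 1 + p 1 * q 0) * hk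

/-- The `(−2)`-vector `e₂ − f₂` of `((E₈(−1)^{⊕m} ⊕ U) ⊕ U) ⊕ ℤ(−2d)` (in the split-off plane), its dual vector `f₂`,
and its square. [cite: GritsenkoHulekSankaran2008Proportionality, Prop. 2.4 (ii) proof ("we can find a `(−2)`-vector `r` in the sublattice `U ⊕ ⟨−2d⟩`")] -/
theorem splitModel_negTwoVector_one :
    ((((LinearMap.BilinForm.pi fun _ : Fin m ↦ -e8Form).prod (hyperbolicSum 1)).prod hyperbolicForm).prod
        ((-(2 * d : ℤ)) • LinearMap.mul ℤ ℤ))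
          (((0 : (Fin m → Fin 8 → ℤ) × ((Fin 1 → ℤ) × (Fin 1 → ℤ))), ![1, -1]), 0)
          (((0 : (Fin m → Fin 8 → ℤ) × ((Fin 1 → ℤ) × (Fin 1 → ℤ))), ![1, -1]), 0) = -2 ∧
      ((((LinearMap.BilinForm.pi fun _ : Fin m ↦ -e8Form).prod (hyperbolicSum 1)).prod hyperbolicForm).prod
        ((-(2 * d : ℤ)) • LinearMap.mul ℤ ℤ))
          (((0 : (Fin m → Fin 8 → ℤ) × ((Fin 1 → ℤ) × (Fin 1 → ℤ))), ![1, -1]), 0)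
          (((0 : (Fin m → Fin 8 → ℤ) × ((Fin 1 → ℤ) × (Fin 1 → ℤ))), ![0, 1]), 0) = 1 := by
  constructor <;> simp [LinearMap.BilinForm.prod_apply, hyperbolicForm_apply]

/-- The `(−2)`-vector `2e₂ + 2kf₂ + h` of `((E₈(−1)^{⊕m} ⊕ U) ⊕ U) ⊕ ℤ(−2d)` for `d = 4k + 1`: its square is `−2` and all
its products are even. [cite: GritsenkoHulekSankaran2008Proportionality, Prop. 2.4 (ii) proof] -/
theorem splitModel_negTwoVector_two {k : ℤ} (hk : (d : ℤ) = 4 * k + 1) :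
    ((((LinearMap.BilinForm.pi fun _ : Fin m ↦ -e8Form).prod (hyperbolicSum 1)).prod hyperbolicForm).prod
        ((-(2 * d : ℤ)) • LinearMap.mul ℤ ℤ))
          (((0 : (Fin m → Fin 8 → ℤ) × ((Fin 1 → ℤ) × (Fin 1 → ℤ))), ![2, 2 * k]), 1)
          (((0 : (Fin m → Fin 8 → ℤ) × ((Fin 1 → ℤ) × (Fin 1 → ℤ))), ![2, 2 * k]), 1) = -2 ∧
      ∀ z, (2 : ℤ) ∣ ((((LinearMap.BilinForm.pi fun _ : Fin m ↦ -e8Form).prod (hyperbolicSum 1)).prod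
        hyperbolicForm).prod ((-(2 * d : ℤ)) • LinearMap.mul ℤ ℤ))
          (((0 : (Fin m → Fin 8 → ℤ) × ((Fin 1 → ℤ) × (Fin 1 → ℤ))), ![2, 2 * k]), 1) z := by
  constructor
  · simp [LinearMap.BilinForm.prod_apply, hyperbolicForm_apply, hk]
    ring
  · intro z
    simp only [LinearMap.BilinForm.prod_apply, hyperbolicForm_apply, smul_mul_apply, map_zero, LinearMap.zero_apply,
      zero_add, Matrix.cons_val_zero, Matrix.cons_val_one]
    exact ⟨z.1.2 1 + k * z.1.2 0 - d * z.2, by ring⟩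

/-- **GHS Prop. 2.4 (ii), the complement `K_{2d}^{(m)}`: "The orthogonal complement of a `(−2)`-vector `r` in
`L_{2d}^{(m)}` is isometric to `K_{2d}^{(m)} = U ⊕ mE₈(−1) ⊕ ⟨2⟩ ⊕ ⟨−2d⟩, if `div(r) = 1`"** — for the model
`L_{2d}^{(m)} = (E₈(−1)^{⊕m} ⊕ U^{⊕2}) ⊕ ℤ(−2d)` (`d ≥ 1`) and a `(−2)`-vector `r` with a dual vector (`(r, r') = 1`):
`r^⊥ ≅ ((E₈(−1)^{⊕m} ⊕ U) ⊕ ⟨2⟩) ⊕ ⟨−2d⟩`. Proof as printed: move `r` to `e₂ − f₂` (one orbit) and split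
`(e₂ − f₂)^⊥ = (E₈(−1)^{⊕m} ⊕ U₁) ⊕ ℤ(e₂ + f₂) ⊕ ℤh`. [cite: GritsenkoHulekSankaran2008Proportionality, Prop. 2.4 (ii)] [cite: GritsenkoHulekSankaran2007HM, §4.6.1 ("`K_{2d}^{(m)} = U ⊕ mE₈(−1) ⊕ ⟨2⟩ ⊕ ⟨−2d⟩`")] -/
theorem restrict_orthogonal_latticeL2dm_equivalent_of_apply_eq_one (hd : 0 < d)
    {r r' : ((Fin m → Fin 8 → ℤ) × ((Fin 2 → ℤ) × (Fin 2 → ℤ))) × ℤ}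
    (hr : (((LinearMap.BilinForm.pi fun _ : Fin m ↦ -e8Form).prod (hyperbolicSum 2)).prod
      ((-(2 * d : ℤ)) • LinearMap.mul ℤ ℤ)) r r = -2)
    (hr' : (((LinearMap.BilinForm.pi fun _ : Fin m ↦ -e8Form).prod (hyperbolicSum 2)).prod
      ((-(2 * d : ℤ)) • LinearMap.mul ℤ ℤ)) r r' = 1) :
    (((((LinearMap.BilinForm.pi fun _ : Fin m ↦ -e8Form).prod (hyperbolicSum 2)).prod
        ((-(2 * d : ℤ)) • LinearMap.mul ℤ ℤ)).restrict
      ((((LinearMap.BilinForm.pi fun _ : Fin m ↦ -e8Form).prod (hyperbolicSum 2)).prod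
        ((-(2 * d : ℤ)) • LinearMap.mul ℤ ℤ)).orthogonal (ℤ ∙ r)))).Equivalent
      ((((LinearMap.BilinForm.pi fun _ : Fin m ↦ -e8Form).prod (hyperbolicSum 1)).prod
        ((2 : ℤ) • LinearMap.mul ℤ ℤ)).prod ((-(2 * d : ℤ)) • LinearMap.mul ℤ ℤ)) := by
  obtain ⟨-, heB, huB⟩ := isSymm_isEven_isUnimodular_pi_neg_e8Form_prod_hyperbolicSum_two m
  -- split off the second hyperbolic plane: `φ : L ≅ L' = ((E₈(−1)^{⊕m} ⊕ U) ⊕ U) ⊕ ℤ(−2d)`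
  obtain ⟨e₁⟩ : ((LinearMap.BilinForm.pi fun _ : Fin m ↦ -e8Form).prod (hyperbolicSum 2)).Equivalent
      (((LinearMap.BilinForm.pi fun _ : Fin m ↦ -e8Form).prod (hyperbolicSum 1)).prod hyperbolicForm) :=
    prod_hyperbolicSum_succ_equivalent _ 1
  let φ := e₁.prodCongr (LinearMap.BilinForm.IsometryEquiv.refl ((-(2 * d : ℤ)) • LinearMap.mul ℤ ℤ))
  -- the representative `e₂ − f₂`, pulled back to `L`
  obtain ⟨h1, h1'⟩ := splitModel_negTwoVector_one m d
  set r₁ := φ.symm (((0 : (Fin m → Fin 8 → ℤ) × ((Fin 1 → ℤ) × (Fin 1 → ℤ))), ![1, -1]), 0) with hr₁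
  have hφr₁ : φ r₁ = (((0 : (Fin m → Fin 8 → ℤ) × ((Fin 1 → ℤ) × (Fin 1 → ℤ))), ![1, -1]), 0) :=
    φ.toLinearEquiv.apply_symm_apply _
  have hr₁r₁ : (((LinearMap.BilinForm.pi fun _ : Fin m ↦ -e8Form).prod (hyperbolicSum 2)).prod
      ((-(2 * d : ℤ)) • LinearMap.mul ℤ ℤ)) r₁ r₁ = -2 := by
    rw [hr₁, φ.symm.map_app]
    exact h1
  obtain ⟨z, hz⟩ := (exists_apply_eq_iff_of_isometryEquiv φ.symm _ 1).2 ⟨_, h1'⟩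
  -- one orbit: `g r = r₁`
  obtain ⟨g, -, hg⟩ := exists_isometryEquiv_apply_eq_of_apply_self_eq_neg_two_of_apply_eq_one d huB heB hd
    (twoHyperbolicPairs_pi_neg_e8Form_prod_hyperbolicSum_two m) hr hr₁r₁ hr' hz
  have hA := restrict_orthogonal_equivalent_of_isometryEquiv g r
  rw [hg] at hA
  have hB := restrict_orthogonal_equivalent_of_isometryEquiv φ r₁
  rw [hφr₁] at hB
  -- `(e₂ − f₂)^⊥ = ((E₈(−1)^{⊕m} ⊕ U₁) ⊕ (e₂ − f₂)^⊥_U) ⊕ ℤh ≅ ((E₈(−1)^{⊕m} ⊕ U₁) ⊕ ⟨2⟩) ⊕ ⟨−2d⟩`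
  have hC := restrict_orthogonal_prod_zero_equivalent
    (((LinearMap.BilinForm.pi fun _ : Fin m ↦ -e8Form).prod (hyperbolicSum 1)).prod hyperbolicForm)
    ((-(2 * d : ℤ)) • LinearMap.mul ℤ ℤ) (((0 : (Fin m → Fin 8 → ℤ) × ((Fin 1 → ℤ) × (Fin 1 → ℤ))), ![1, -1]))
  have hD := restrict_orthogonal_zero_prod_equivalent
    ((LinearMap.BilinForm.pi fun _ : Fin m ↦ -e8Form).prod (hyperbolicSum 1)) hyperbolicForm (![1, -1] : Fin 2 → ℤ)
  have hE := restrict_orthogonal_hyperbolicForm_equivalent (-1 : ℤ)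
  have h2 : (-(2 * (-1 : ℤ))) = 2 := by norm_num
  rw [h2] at hE
  exact hA.trans (hB.trans (hC.trans ((hD.trans ((Equivalent.refl _).prod hE)).prod (Equivalent.refl _))))

/-- **GHS Prop. 2.4 (ii), the complement `N_{2d}^{(m)}`: "… and to `N_{2d}^{(m)} = U ⊕ mE₈(−1) ⊕ (2 1 ∕ 1 (1−d)∕2)`,
if `div(r) = 2`"** — for the model `L_{2d}^{(m)}` with `d = 4k + 1` and a `(−2)`-vector `r` all of whose products are
even: `r^⊥ ≅ (E₈(−1)^{⊕m} ⊕ U) ⊕ (2 1 ∕ 1 −2k)`. (`div(r) = 2` forces `d ≡ 1 (mod 4)`: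
`odd_snd_and_mod_four_eq_one_of_forall_two_dvd`.) Proof as printed: move `r` to `2e₂ + 2kf₂ + h` (one orbit) and
compute `(2e₂ + 2kf₂ + h)^⊥ = (E₈(−1)^{⊕m} ⊕ U₁) ⊕ ⟨2e₂ + (2k+1)f₂ + h, e₂ − kf₂⟩`. [cite: GritsenkoHulekSankaran2008Proportionality, Prop. 2.4 (ii)] [cite: GritsenkoHulekSankaran2007HM, §4.6.2 ("`N_{2d}^{(m)} = U ⊕ mE₈(−1) ⊕ (2 1 ∕ 1 (1−d)∕2)`")] -/
theorem restrict_orthogonal_latticeL2dm_equivalent_of_forall_two_dvd (hd : 0 < d) {k : ℤ}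
    (hk : (d : ℤ) = 4 * k + 1) {r : ((Fin m → Fin 8 → ℤ) × ((Fin 2 → ℤ) × (Fin 2 → ℤ))) × ℤ}
    (hr : (((LinearMap.BilinForm.pi fun _ : Fin m ↦ -e8Form).prod (hyperbolicSum 2)).prod
      ((-(2 * d : ℤ)) • LinearMap.mul ℤ ℤ)) r r = -2)
    (h2 : ∀ z, (2 : ℤ) ∣ (((LinearMap.BilinForm.pi fun _ : Fin m ↦ -e8Form).prod (hyperbolicSum 2)).prod
      ((-(2 * d : ℤ)) • LinearMap.mul ℤ ℤ)) r z) :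
    (((((LinearMap.BilinForm.pi fun _ : Fin m ↦ -e8Form).prod (hyperbolicSum 2)).prod
        ((-(2 * d : ℤ)) • LinearMap.mul ℤ ℤ)).restrict
      ((((LinearMap.BilinForm.pi fun _ : Fin m ↦ -e8Form).prod (hyperbolicSum 2)).prod
        ((-(2 * d : ℤ)) • LinearMap.mul ℤ ℤ)).orthogonal (ℤ ∙ r)))).Equivalent
      (((LinearMap.BilinForm.pi fun _ : Fin m ↦ -e8Form).prod (hyperbolicSum 1)).prod
        (Matrix.toBilin' !![2, 1; 1, -(2 * k)])) := by
  obtain ⟨-, heB, huB⟩ := isSymm_isEven_isUnimodular_pi_neg_e8Form_prod_hyperbolicSum_two m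
  obtain ⟨e₁⟩ : ((LinearMap.BilinForm.pi fun _ : Fin m ↦ -e8Form).prod (hyperbolicSum 2)).Equivalent
      (((LinearMap.BilinForm.pi fun _ : Fin m ↦ -e8Form).prod (hyperbolicSum 1)).prod hyperbolicForm) :=
    prod_hyperbolicSum_succ_equivalent _ 1
  let φ := e₁.prodCongr (LinearMap.BilinForm.IsometryEquiv.refl ((-(2 * d : ℤ)) • LinearMap.mul ℤ ℤ))
  -- the representative `2e₂ + 2kf₂ + h`, pulled back to `L`
  obtain ⟨h1, h1'⟩ := splitModel_negTwoVector_two m d hk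
  set r₂ := φ.symm (((0 : (Fin m → Fin 8 → ℤ) × ((Fin 1 → ℤ) × (Fin 1 → ℤ))), ![2, 2 * k]), 1) with hr₂
  have hφr₂ : φ r₂ = (((0 : (Fin m → Fin 8 → ℤ) × ((Fin 1 → ℤ) × (Fin 1 → ℤ))), ![2, 2 * k]), 1) :=
    φ.toLinearEquiv.apply_symm_apply _
  have hr₂r₂ : (((LinearMap.BilinForm.pi fun _ : Fin m ↦ -e8Form).prod (hyperbolicSum 2)).prod
      ((-(2 * d : ℤ)) • LinearMap.mul ℤ ℤ)) r₂ r₂ = -2 := by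
    rw [hr₂, φ.symm.map_app]
    exact h1
  have h2r₂ := (forall_dvd_apply_iff_of_isometryEquiv φ.symm
    (((0 : (Fin m → Fin 8 → ℤ) × ((Fin 1 → ℤ) × (Fin 1 → ℤ))), ![2, 2 * k]), 1) 2).2 h1'
  -- one orbit: `g r = r₂`
  obtain ⟨g, -, hg⟩ := exists_isometryEquiv_apply_eq_of_apply_self_eq_neg_two_of_forall_two_dvd d huB heB hd
    (twoHyperbolicPairs_pi_neg_e8Form_prod_hyperbolicSum_two m) hr hr₂r₂ h2 h2r₂
  have hA := restrict_orthogonal_equivalent_of_isometryEquiv g r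
  rw [hg] at hA
  have hB := restrict_orthogonal_equivalent_of_isometryEquiv φ r₂
  rw [hφr₂] at hB
  -- re-bracket `L' ≅ (E₈(−1)^{⊕m} ⊕ U₁) ⊕ (U₂ ⊕ ℤh)` and split `(0, v)^⊥ = (E₈(−1)^{⊕m} ⊕ U₁) ⊕ v^⊥`
  let ψ := LinearMap.BilinForm.IsometryEquiv.prodAssoc ((LinearMap.BilinForm.pi fun _ : Fin m ↦ -e8Form).prod (hyperbolicSum 1))
    hyperbolicForm ((-(2 * d : ℤ)) • LinearMap.mul ℤ ℤ)
  have hB' := restrict_orthogonal_equivalent_of_isometryEquiv ψ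
    (((0 : (Fin m → Fin 8 → ℤ) × ((Fin 1 → ℤ) × (Fin 1 → ℤ))), ![2, 2 * k]), 1)
  have hψ : ψ (((0 : (Fin m → Fin 8 → ℤ) × ((Fin 1 → ℤ) × (Fin 1 → ℤ))), ![2, 2 * k]), 1) =
      ((0 : (Fin m → Fin 8 → ℤ) × ((Fin 1 → ℤ) × (Fin 1 → ℤ))), ((![2, 2 * k] : Fin 2 → ℤ), (1 : ℤ))) := rfl
  rw [hψ] at hB'
  have hC := restrict_orthogonal_zero_prod_equivalent
    ((LinearMap.BilinForm.pi fun _ : Fin m ↦ -e8Form).prod (hyperbolicSum 1))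
    (hyperbolicForm.prod ((-(2 * d : ℤ)) • LinearMap.mul ℤ ℤ)) ((![2, 2 * k] : Fin 2 → ℤ), (1 : ℤ))
  have hD := restrict_orthogonal_hyperbolicForm_prod_neg_twoMul_smul_mul_equivalent d hk
  exact hA.trans (hB.trans (hB'.trans (hC.trans ((Equivalent.refl _).prod hD))))

end Model

end Literature.Topology.FourManifolds

end
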